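import Mathlib
import Literature.Analysis.FluidPDE.VorticityCalculus
import Literature.Analysis.FluidPDE.VorticityFormulationHolds
import Literature.Analysis.FluidPDE.AxisymmetricVorticityTransport
import Literature.Analysis.FluidPDE.VectorCalculusProofs
import Literature.Analysis.FluidPDE.LambFormCurlKernel
import Literature.Analysis.FluidPDE.ClassicalSuitableRegion
import Literature.Analysis.FluidPDE.BiotSavartIntegral
import Literature.Analysis.FluidPDE.EnergyToolkit
import Literature.Analysis.FluidPDE.WholeSpaceIBP
import HarnessLib

/-!
# The HELICITY of a classical Euler flow against a compactly supported weight — the cut-off balance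
# (helper of the DSS zero-helicity constraint for the crux `EulerZoomLiouville.PowerGaugeEulerLiouville`,
# route №10, item stmt-NavierStokesRegularity-19832)

Helper file (theorems only; `--supports stmt-NavierStokesRegularity-19832`). Seat ns-typeII-p3 (cell
ns-regularity-ideate §B, D-0081). For a classical Euler flow `(u, p)` on `[0, T] × ℝ³` and a `C¹`
compactly supported scalar weight `φ`, the weighted helicity `h_φ(t) = ∫ φ ⟪u(t), curl u(t)⟫` obeys
(`integral_weight_helicity_sub_eq`)
`h_φ(T) − h_φ(0) = ∫₀ᵀ ( 2∫ (p + ½|u|²) Dφ[ω] + ∫ ⟪∂ₜu, curlCLM(Dφ ⊗ u)⟫ ) dσ`,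
i.e. only FLUX terms through the support of `Dφ` (the second term is `⟪∂ₜu, ∇φ × u⟫`): the local
form of the conservation of helicity, Majda–Bertozzi §1.7 Prop. 1.12 (iv),
`(u·ω)ₜ + div[u(u·ω) + ω(p − ½|u|²)] = 0`. The tree's `euler_helicity_conservation_holds` assumes
UNIFORM RAPID DECAY of `u`; the point here is that NO decay is assumed — decay enters only when the
weight is sent to `1` (sequel `…DSSHelicity.lean`), and there the natural algebraic tails of self-similar
Euler collapse (`|u| ~ |y|^{−(1+ρ)}`, `|ω| ~ |y|^{−(2+ρ)}`) suffice.

Proof: polarisation of the tree's `∫∫φ⟪∂ₜw, w⟫ = ½∫φ|w|² |₀ᵀ` (`EnergyToolkit`) with `w = u + ω, u, ω`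
gives `h_φ(T) − h_φ(0) = ∫₀ᵀ∫φ(⟪∂ₜu, ω⟫ + ⟪∂ₜω, u⟫)`; `∂ₜω = curl ∂ₜu` and the self-adjointness of
`curl` against `φu ∈ C¹_c` (`integral_inner_curl_eq_integral_inner_curl`, Leibniz `curl_smul`) turn the
second term into `∫φ⟪∂ₜu, ω⟫ + ∫⟪∂ₜu, curlCLM(Dφ ⊗ u)⟫`; finally `⟪∂ₜu, ω⟫ = −⟪∇(p + ½|u|²), ω⟫`
(Euler + Lamb form, `⟪ω × u, ω⟫ = 0`, cf. the tree's `DepletionLadder.inner_cross_curl_left`) and `∫⟪ω, ∇(φB)⟫ = 0` (`div ω = 0`).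

WHAT THIS IS NOT: not NS, not the crux — a calculus identity for classical Euler flows. [folklore]
-/

noncomputable section

-- the summit and its single problem share the name `NavierStokesRegularity` (D-0017 nested layout)
set_option linter.dupNamespace false

open Set Function Filter Topology MeasureTheory Metric
open scoped NNReal ENNReal InnerProductSpace RealInnerProductSpace

namespace Summit.NavierStokesRegularity.NavierStokesRegularity.Theorems.PowerGaugeEulerLiouville.Helicity

open Literature.Analysis Literature.Analysis.FluidPDE

/-! ## Pointwise tools -/

/-- `⟪w, ∇g(x)⟫ = Dg(x)[w]`. [folklore] -/
theorem inner_gradient_eq_fderiv (g : (EuclideanSpace ℝ (Fin 3)) → ℝ) (x w : EuclideanSpace ℝ (Fin 3)) :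
    ⟪w, gradient g x⟫ = fderiv ℝ g x w := by
  rw [real_inner_comm, gradient, InnerProductSpace.toDual_symm_apply]

/-- `⟪∇g(x), w⟫ = Dg(x)[w]`. [folklore] -/
theorem inner_gradient_eq_fderiv' (g : (EuclideanSpace ℝ (Fin 3)) → ℝ) (x w : EuclideanSpace ℝ (Fin 3)) :
    ⟪gradient g x, w⟫ = fderiv ℝ g x w := by
  rw [real_inner_comm]; exact inner_gradient_eq_fderiv g x w

/-- Leibniz rule inside the gradient pairing: `⟪w, ∇(φH)(x)⟫ = φ(x) DH(x)[w] + H(x) Dφ(x)[w]`. [folklore] -/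
theorem inner_gradient_mul_eq {φ H : (EuclideanSpace ℝ (Fin 3)) → ℝ} {x : EuclideanSpace ℝ (Fin 3)}
    (hφ : DifferentiableAt ℝ φ x) (hH : DifferentiableAt ℝ H x) (w : EuclideanSpace ℝ (Fin 3)) :
    ⟪w, gradient (fun y => φ y * H y) x⟫ = φ x * fderiv ℝ H x w + H x * fderiv ℝ φ x w := by
  rw [inner_gradient_eq_fderiv, fderiv_fun_mul hφ hH]
  simp only [add_apply, smul_apply, smul_eq_mul]

/-- Polarisation: `⟪a + b, a + b⟫`-type expansion `‖a + b‖² − ‖a‖² − ‖b‖² = 2⟪a, b⟫`. [folklore] -/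
theorem norm_add_sq_sub_sub (a b : EuclideanSpace ℝ (Fin 3)) :
    ‖a + b‖ ^ 2 - ‖a‖ ^ 2 - ‖b‖ ^ 2 = 2 * ⟪a, b⟫ := by
  rw [norm_add_sq_real]; ring

section Balance

variable {T : ℝ} {v : ℝ → (EuclideanSpace ℝ (Fin 3)) → (EuclideanSpace ℝ (Fin 3))}
  {p : ℝ → (EuclideanSpace ℝ (Fin 3)) → ℝ} {φ : (EuclideanSpace ℝ (Fin 3)) → ℝ}

/-- **The source of the weighted helicity at a fixed time.** For a classical Euler flow on `[0, T]`,
`σ ∈ [0, T]`, and `φ ∈ C¹_c`: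
`∫ φ (⟪∂ₜu, ω⟫ + ⟪∂ₜω, u⟫) = 2∫ (p + ½|u|²) Dφ[ω] + ∫ ⟪∂ₜu, curlCLM(Dφ ⊗ u)⟫`. [folklore] -/
theorem integral_weight_helicity_source_eq (hT : 0 < T) (hv : IsClassicalNSSolutionOn (Icc 0 T) 0 0 v p)
    (hφ : ContDiff ℝ 1 φ) (hφc : HasCompactSupport φ) {σ : ℝ} (hσ : σ ∈ Icc 0 T) :
    ∫ x, φ x * (⟪FluidPDE.timeDerivWithin (Icc 0 T) v σ x, curl (v σ) x⟫ +
        ⟪FluidPDE.timeDerivWithin (Icc 0 T) (vorticity v) σ x, v σ x⟫) =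
      2 * (∫ x, (p σ x + ‖v σ x‖ ^ 2 / 2) * fderiv ℝ φ x (curl (v σ) x)) +
        ∫ x, ⟪FluidPDE.timeDerivWithin (Icc 0 T) v σ x,
          curlCLM ((fderiv ℝ φ x).smulRight (v σ x))⟫ := by
  have hS : UniqueDiffOn ℝ (Icc 0 T) := uniqueDiffOn_Icc hT
  -- regularity
  have hv1 : ContDiff ℝ 1 (v σ) := (hv.contDiff_velocity hσ).of_le (by norm_cast)
  have hv2 : ContDiff ℝ 2 (v σ) := (hv.contDiff_velocity hσ).of_le (by norm_cast)
  have hp1 : ContDiff ℝ 1 (p σ) := (hv.contDiff_pressure hσ).of_le (by norm_cast)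
  have hω1 : ContDiff ℝ 1 (curl (v σ)) := contDiff_curl (n := 1) hv2
  have hdt : IsSmoothSpaceTimeOn (Icc 0 T) (FluidPDE.timeDerivWithin (Icc 0 T) v) :=
    hv.smooth_velocity.timeDerivWithin hS
  have hdt1 : ContDiff ℝ 1 (FluidPDE.timeDerivWithin (Icc 0 T) v σ) :=
    (hdt.contDiff_slice hσ).of_le (by norm_cast)
  have hdωt : IsSmoothSpaceTimeOn (Icc 0 T) (FluidPDE.timeDerivWithin (Icc 0 T) (vorticity v)) :=
    (hv.smooth_velocity.isSmoothSpaceTimeOn_vorticity hS).timeDerivWithin hS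
  set dv : (EuclideanSpace ℝ (Fin 3)) → (EuclideanSpace ℝ (Fin 3)) := FluidPDE.timeDerivWithin (Icc 0 T) v σ with hdv
  -- `∂ₜω = curl ∂ₜu`
  have hωt : ∀ x, FluidPDE.timeDerivWithin (Icc 0 T) (vorticity v) σ x = curl dv x := fun x =>
    (hv.smooth_velocity.curl_timeDerivWithin_of_uniqueDiffOn hS hσ x).symm
  -- continuity of the pieces
  have hφc' : HasCompactSupport (fderiv ℝ φ) := hφc.fderiv (𝕜 := ℝ)
  have hφ0 : Continuous φ := hφ.continuous
  have hDφ0 : Continuous (fun x => fderiv ℝ φ x) := hφ.continuous_fderiv one_ne_zero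
  have hω0 : Continuous (curl (v σ)) := hω1.continuous
  have hdv0 : Continuous dv := hdt1.continuous
  -- integrability of `B · Dφ[ω]` for continuous `B` (compact support of `Dφ`)
  have hiB : ∀ {B : (EuclideanSpace ℝ (Fin 3)) → ℝ}, Continuous B →
      Integrable (fun x => B x * fderiv ℝ φ x (curl (v σ) x)) := by
    intro B hB
    refine (hB.mul (hDφ0.clm_apply hω0)).integrable_of_hasCompactSupport (hφc'.mono fun x hx => ?_)
    contrapose! hx
    simp only [mem_support, not_not] at hx
    simp [hx]
  -- (1) the second term: self-adjointness of `curl` against `φ • v` (tree `integral_mul_inner_curl_eq`)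
  have h2 : ∫ x, φ x * ⟪FluidPDE.timeDerivWithin (Icc 0 T) (vorticity v) σ x, v σ x⟫ =
      (∫ x, φ x * ⟪dv x, curl (v σ) x⟫) +
        ∫ x, ⟪dv x, curlCLM ((fderiv ℝ φ x).smulRight (v σ x))⟫ := by
    have e1 : (∫ x, φ x * ⟪FluidPDE.timeDerivWithin (Icc 0 T) (vorticity v) σ x, v σ x⟫) =
        ∫ x, φ x * ⟪curl dv x, v σ x⟫ :=
      integral_congr_ae (Eventually.of_forall fun x => by beta_reduce; rw [hωt x])
    rw [e1]
    exact integral_mul_inner_curl_eq hdt1 hv1 hφ hφc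
  -- (2) the first term: Euler + Lamb form + `div ω = 0`
  have hmom : ∀ x, dv x = -gradient (p σ) x -
      (cross (curl (v σ) x) (v σ x) + gradient (fun y => ‖v σ y‖ ^ 2 / 2) x) := by
    intro x
    have h := hv.momentum σ hσ x
    simp only [zero_smul, Pi.zero_apply, add_zero, zero_sub] at h
    rw [convect_self_eq_cross_curl_add_gradient ((hv1.differentiable one_ne_zero) x)] at h
    rw [hdv]
    exact eq_sub_of_add_eq h
  have hinner : ∀ x, ⟪dv x, curl (v σ) x⟫ =
      -(fderiv ℝ (fun y => ‖v σ y‖ ^ 2 / 2) x (curl (v σ) x)) - fderiv ℝ (p σ) x (curl (v σ) x) := by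
    intro x
    -- the Lamb vector is orthogonal to the vorticity (tree: `DepletionLadder.inner_cross_curl_left`)
    have hx0 : ⟪cross (curl (v σ) x) (v σ x), curl (v σ) x⟫ = 0 := by
      have h := inner_cross_left_eq_neg (curl (v σ) x) (v σ x) (curl (v σ) x)
      have h2 : ⟪curl (v σ) x, cross (curl (v σ) x) (v σ x)⟫ = ⟪cross (curl (v σ) x) (v σ x), curl (v σ) x⟫ :=
        real_inner_comm _ _
      linarith
    rw [hmom x, inner_sub_left, inner_neg_left, inner_add_left, hx0,
      inner_gradient_eq_fderiv', inner_gradient_eq_fderiv']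
    ring
  -- the two integrations by parts `∫ ⟪ω, ∇(φ B)⟫ = 0`
  have hkin1 : ContDiff ℝ 1 (fun y => ‖v σ y‖ ^ 2 / 2) := (hv1.norm_sq ℝ).div_const 2
  have hibp : ∀ {B : (EuclideanSpace ℝ (Fin 3)) → ℝ}, ContDiff ℝ 1 B →
      ∫ x, φ x * fderiv ℝ B x (curl (v σ) x) = -∫ x, B x * fderiv ℝ φ x (curl (v σ) x) := by
    intro B hB
    have hθ : ContDiff ℝ 1 (fun y => φ y * B y) := hφ.mul hB
    have hθc : HasCompactSupport (fun y => φ y * B y) := hφc.mul_right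
    have h0 := integral_inner_gradient_eq_zero_of_divergence_eq_zero hω1 hθ hθc
      (fun x _ => divergence_curl_eq_zero_holds (v σ) hv2 x)
    have e : ∀ x, ⟪curl (v σ) x, gradient (fun y => φ y * B y) x⟫ =
        φ x * fderiv ℝ B x (curl (v σ) x) + B x * fderiv ℝ φ x (curl (v σ) x) := fun x =>
      inner_gradient_mul_eq ((hφ.differentiable one_ne_zero) x) ((hB.differentiable one_ne_zero) x) _
    rw [integral_congr_ae (Eventually.of_forall e)] at h0
    have hi1 : Integrable (fun x => φ x * fderiv ℝ B x (curl (v σ) x)) :=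
      (hφ0.mul (((hB.continuous_fderiv one_ne_zero).clm_apply hω0))).integrable_of_hasCompactSupport
        hφc.mul_right
    rw [integral_add hi1 (hiB hB.continuous)] at h0
    linarith
  have h1 : ∫ x, φ x * ⟪dv x, curl (v σ) x⟫ =
      ∫ x, (p σ x + ‖v σ x‖ ^ 2 / 2) * fderiv ℝ φ x (curl (v σ) x) := by
    have e1 : ∀ x, φ x * ⟪dv x, curl (v σ) x⟫ =
        -(φ x * fderiv ℝ (fun y => ‖v σ y‖ ^ 2 / 2) x (curl (v σ) x)) -
          φ x * fderiv ℝ (p σ) x (curl (v σ) x) := fun x => by rw [hinner x]; ring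
    have hi1 : Integrable (fun x => φ x * fderiv ℝ (fun y => ‖v σ y‖ ^ 2 / 2) x (curl (v σ) x)) :=
      (hφ0.mul (((hkin1.continuous_fderiv one_ne_zero).clm_apply hω0))).integrable_of_hasCompactSupport
        hφc.mul_right
    have hi2 : Integrable (fun x => φ x * fderiv ℝ (p σ) x (curl (v σ) x)) :=
      (hφ0.mul (((hp1.continuous_fderiv one_ne_zero).clm_apply hω0))).integrable_of_hasCompactSupport
        hφc.mul_right
    rw [integral_congr_ae (Eventually.of_forall e1), integral_sub hi1.fun_neg hi2, integral_neg,
      hibp hkin1, hibp hp1, neg_neg, sub_neg_eq_add,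
      ← integral_add (hiB hkin1.continuous) (hiB hp1.continuous)]
    exact integral_congr_ae (Eventually.of_forall fun x => by ring)
  -- assemble
  have hia : Integrable (fun x => φ x * ⟪dv x, curl (v σ) x⟫) :=
    (hφ0.mul (hdv0.inner hω0)).integrable_of_hasCompactSupport hφc.mul_right
  have hib : Integrable (fun x => φ x * ⟪FluidPDE.timeDerivWithin (Icc 0 T) (vorticity v) σ x, v σ x⟫) :=
    (hφ0.mul ((hdωt.contDiff_slice hσ).continuous.inner hv1.continuous)).integrable_of_hasCompactSupport
      hφc.mul_right
  have esplit : (∫ x, φ x * (⟪dv x, curl (v σ) x⟫ +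
      ⟪FluidPDE.timeDerivWithin (Icc 0 T) (vorticity v) σ x, v σ x⟫)) =
      (∫ x, φ x * ⟪dv x, curl (v σ) x⟫) +
        ∫ x, φ x * ⟪FluidPDE.timeDerivWithin (Icc 0 T) (vorticity v) σ x, v σ x⟫ := by
    rw [← integral_add hia hib]
    exact integral_congr_ae (Eventually.of_forall fun x => by ring)
  rw [esplit, h2, h1]
  ring

/-- **The cut-off helicity balance.** For a classical Euler flow on `[0, T]` (`T > 0`) and a `C¹`
compactly supported weight `φ`:
`∫φ⟪u(T), ω(T)⟫ − ∫φ⟪u(0), ω(0)⟫ = ∫₀ᵀ ( 2∫ (p + ½|u|²) Dφ[ω] + ∫ ⟪∂ₜu, curlCLM(Dφ ⊗ u)⟫ ) dσ`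
(only flux terms through the support of `Dφ`; Majda–Bertozzi Prop. 1.12 (iv) in local form). [folklore] -/
theorem integral_weight_helicity_sub_eq (hT : 0 < T) (hv : IsClassicalNSSolutionOn (Icc 0 T) 0 0 v p)
    (hφ : ContDiff ℝ 1 φ) (hφc : HasCompactSupport φ) :
    (∫ x, φ x * ⟪v T x, curl (v T) x⟫) - (∫ x, φ x * ⟪v 0 x, curl (v 0) x⟫) =
      ∫ σ in Ioo 0 T, (2 * (∫ x, (p σ x + ‖v σ x‖ ^ 2 / 2) * fderiv ℝ φ x (curl (v σ) x)) +
        ∫ x, ⟪FluidPDE.timeDerivWithin (Icc 0 T) v σ x, curlCLM ((fderiv ℝ φ x).smulRight (v σ x))⟫) := by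
  have hS : UniqueDiffOn ℝ (Icc 0 T) := uniqueDiffOn_Icc hT
  have hTm : T ∈ Icc 0 T := ⟨hT.le, le_rfl⟩
  have h0m : (0 : ℝ) ∈ Icc 0 T := ⟨le_rfl, hT.le⟩
  have hφ0 : Continuous φ := hφ.continuous
  have hu : IsSmoothSpaceTimeOn (Icc 0 T) v := hv.smooth_velocity
  have hω : IsSmoothSpaceTimeOn (Icc 0 T) (vorticity v) := hu.isSmoothSpaceTimeOn_vorticity hS
  have hw : IsSmoothSpaceTimeOn (Icc 0 T) (fun s x => v s x + vorticity v s x) := hu.add hω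
  -- the three polarisation identities
  have hA := hw.integral_Ioo_integral_mul_inner_timeDerivWithin hT hφ0 hφc le_rfl hT.le le_rfl
  have hB := hu.integral_Ioo_integral_mul_inner_timeDerivWithin hT hφ0 hφc le_rfl hT.le le_rfl
  have hC := hω.integral_Ioo_integral_mul_inner_timeDerivWithin hT hφ0 hφc le_rfl hT.le le_rfl
  -- continuity in `σ` of the three time integrands (parametric integrals with compact support)
  have hcont : ∀ {w : ℝ → (EuclideanSpace ℝ (Fin 3)) → (EuclideanSpace ℝ (Fin 3))},
      IsSmoothSpaceTimeOn (Icc 0 T) w →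
      ContinuousOn (fun σ => ∫ x, φ x * ⟪FluidPDE.timeDerivWithin (Icc 0 T) w σ x, w σ x⟫) (Icc 0 T) :=
    fun hw' => continuousOn_integral_mul_of_continuousOn (G := fun z : ℝ × (EuclideanSpace ℝ (Fin 3)) =>
        ⟪FluidPDE.timeDerivWithin (Icc 0 T) _ z.1 z.2, _⟫) hφ0 hφc
      ((hw'.continuousOn_timeDerivWithin hS).inner hw'.continuousOn)
  have hiA : IntegrableOn (fun σ => ∫ x, φ x * ⟪FluidPDE.timeDerivWithin (Icc 0 T)
      (fun s x => v s x + vorticity v s x) σ x, v σ x + vorticity v σ x⟫) (Ioo 0 T) :=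
    (hcont hw).integrableOn_Icc.mono_set Ioo_subset_Icc_self
  have hiB : IntegrableOn (fun σ => ∫ x, φ x * ⟪FluidPDE.timeDerivWithin (Icc 0 T) v σ x, v σ x⟫)
      (Ioo 0 T) := (hcont hu).integrableOn_Icc.mono_set Ioo_subset_Icc_self
  have hiC : IntegrableOn (fun σ => ∫ x, φ x * ⟪FluidPDE.timeDerivWithin (Icc 0 T) (vorticity v) σ x,
      vorticity v σ x⟫) (Ioo 0 T) := (hcont hω).integrableOn_Icc.mono_set Ioo_subset_Icc_self
  -- pointwise in `σ`: the difference of the three integrands is the helicity source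
  have hσeq : ∀ σ ∈ Ioo 0 T,
      (∫ x, φ x * ⟪FluidPDE.timeDerivWithin (Icc 0 T) (fun s x => v s x + vorticity v s x) σ x,
          v σ x + vorticity v σ x⟫) -
        (∫ x, φ x * ⟪FluidPDE.timeDerivWithin (Icc 0 T) v σ x, v σ x⟫) -
        (∫ x, φ x * ⟪FluidPDE.timeDerivWithin (Icc 0 T) (vorticity v) σ x, vorticity v σ x⟫) =
      2 * (∫ x, (p σ x + ‖v σ x‖ ^ 2 / 2) * fderiv ℝ φ x (curl (v σ) x)) +
        ∫ x, ⟪FluidPDE.timeDerivWithin (Icc 0 T) v σ x, curlCLM ((fderiv ℝ φ x).smulRight (v σ x))⟫ := by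
    intro σ hσ
    have hσ' : σ ∈ Icc 0 T := Ioo_subset_Icc_self hσ
    rw [← integral_weight_helicity_source_eq hT hv hφ hφc hσ']
    -- continuity of the slices
    have hvc : Continuous (v σ) := (hu.contDiff_slice hσ').continuous
    have hωc : Continuous (vorticity v σ) := (hω.contDiff_slice hσ').continuous
    have hdvc : Continuous (FluidPDE.timeDerivWithin (Icc 0 T) v σ) :=
      ((hu.timeDerivWithin hS).contDiff_slice hσ').continuous
    have hdωc : Continuous (FluidPDE.timeDerivWithin (Icc 0 T) (vorticity v) σ) :=
      ((hω.timeDerivWithin hS).contDiff_slice hσ').continuous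
    have hsum : ∀ x, FluidPDE.timeDerivWithin (Icc 0 T) (fun s x => v s x + vorticity v s x) σ x =
        FluidPDE.timeDerivWithin (Icc 0 T) v σ x + FluidPDE.timeDerivWithin (Icc 0 T) (vorticity v) σ x :=
      fun x => hu.timeDerivWithin_fun_add hω hS hσ' x
    have hi1 : Integrable (fun x => φ x * ⟪FluidPDE.timeDerivWithin (Icc 0 T) v σ x, v σ x⟫) :=
      (hφ0.mul (hdvc.inner hvc)).integrable_of_hasCompactSupport hφc.mul_right
    have hi2 : Integrable (fun x => φ x * ⟪FluidPDE.timeDerivWithin (Icc 0 T) (vorticity v) σ x,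
        vorticity v σ x⟫) := (hφ0.mul (hdωc.inner hωc)).integrable_of_hasCompactSupport hφc.mul_right
    have hi0 : Integrable (fun x => φ x * ⟪FluidPDE.timeDerivWithin (Icc 0 T)
        (fun s x => v s x + vorticity v s x) σ x, v σ x + vorticity v σ x⟫) := by
      have h : Integrable (fun x => φ x * ⟪FluidPDE.timeDerivWithin (Icc 0 T) v σ x +
          FluidPDE.timeDerivWithin (Icc 0 T) (vorticity v) σ x, v σ x + vorticity v σ x⟫) :=
        (hφ0.mul ((hdvc.add hdωc).inner (hvc.add hωc))).integrable_of_hasCompactSupport hφc.mul_right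
      exact h.congr (Eventually.of_forall fun x => by simp only [hsum x])
    have split : (∫ x, (φ x * ⟪FluidPDE.timeDerivWithin (Icc 0 T) (fun s x => v s x + vorticity v s x) σ x,
          v σ x + vorticity v σ x⟫ - φ x * ⟪FluidPDE.timeDerivWithin (Icc 0 T) v σ x, v σ x⟫ -
          φ x * ⟪FluidPDE.timeDerivWithin (Icc 0 T) (vorticity v) σ x, vorticity v σ x⟫)) =
        (∫ x, φ x * ⟪FluidPDE.timeDerivWithin (Icc 0 T) (fun s x => v s x + vorticity v s x) σ x,
          v σ x + vorticity v σ x⟫) -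
        (∫ x, φ x * ⟪FluidPDE.timeDerivWithin (Icc 0 T) v σ x, v σ x⟫) -
        (∫ x, φ x * ⟪FluidPDE.timeDerivWithin (Icc 0 T) (vorticity v) σ x, vorticity v σ x⟫) := by
      rw [integral_sub (Integrable.sub' hi0 hi1) hi2, integral_sub hi0 hi1]
    have key : (∫ x, (φ x * ⟪FluidPDE.timeDerivWithin (Icc 0 T) (fun s x => v s x + vorticity v s x) σ x,
          v σ x + vorticity v σ x⟫ - φ x * ⟪FluidPDE.timeDerivWithin (Icc 0 T) v σ x, v σ x⟫ -
          φ x * ⟪FluidPDE.timeDerivWithin (Icc 0 T) (vorticity v) σ x, vorticity v σ x⟫)) =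
        ∫ x, φ x * (⟪FluidPDE.timeDerivWithin (Icc 0 T) v σ x, curl (v σ) x⟫ +
          ⟪FluidPDE.timeDerivWithin (Icc 0 T) (vorticity v) σ x, v σ x⟫) := by
      refine integral_congr_ae (Eventually.of_forall fun x => ?_)
      beta_reduce
      rw [hsum x]
      simp only [inner_add_left, inner_add_right, vorticity_apply]
      ring
    linarith [split, key]
  -- the right-hand sides: `½∫φ(|v+ω|² − |v|² − |ω|²) = ∫φ⟪v, ω⟫`
  have hends : ∀ t ∈ Icc 0 T,
      2⁻¹ * (∫ x, φ x * ‖v t x + vorticity v t x‖ ^ 2) - 2⁻¹ * (∫ x, φ x * ‖v t x‖ ^ 2) -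
        2⁻¹ * (∫ x, φ x * ‖vorticity v t x‖ ^ 2) = ∫ x, φ x * ⟪v t x, curl (v t) x⟫ := by
    intro t ht
    have hvc : Continuous (v t) := (hu.contDiff_slice ht).continuous
    have hωc : Continuous (vorticity v t) := (hω.contDiff_slice ht).continuous
    have hi1 : Integrable (fun x => φ x * ‖v t x + vorticity v t x‖ ^ 2) :=
      (hφ0.mul ((hvc.add hωc).norm.pow 2)).integrable_of_hasCompactSupport hφc.mul_right
    have hi2 : Integrable (fun x => φ x * ‖v t x‖ ^ 2) :=
      (hφ0.mul (hvc.norm.pow 2)).integrable_of_hasCompactSupport hφc.mul_right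
    have hi3 : Integrable (fun x => φ x * ‖vorticity v t x‖ ^ 2) :=
      (hφ0.mul (hωc.norm.pow 2)).integrable_of_hasCompactSupport hφc.mul_right
    have split : (∫ x, (φ x * ‖v t x + vorticity v t x‖ ^ 2 - φ x * ‖v t x‖ ^ 2 -
        φ x * ‖vorticity v t x‖ ^ 2)) = (∫ x, φ x * ‖v t x + vorticity v t x‖ ^ 2) -
        (∫ x, φ x * ‖v t x‖ ^ 2) - ∫ x, φ x * ‖vorticity v t x‖ ^ 2 := by
      rw [integral_sub (Integrable.sub' hi1 hi2) hi3, integral_sub hi1 hi2]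
    have key : (∫ x, (φ x * ‖v t x + vorticity v t x‖ ^ 2 - φ x * ‖v t x‖ ^ 2 -
        φ x * ‖vorticity v t x‖ ^ 2)) = 2 * ∫ x, φ x * ⟪v t x, curl (v t) x⟫ := by
      rw [← integral_const_mul]
      refine integral_congr_ae (Eventually.of_forall fun x => ?_)
      have e := norm_add_sq_sub_sub (v t x) (vorticity v t x)
      simp only [vorticity_apply] at e ⊢
      linear_combination (φ x) * e
    linarith [split, key]
  -- combine
  have hL : (∫ σ in Ioo 0 T, ∫ x, φ x * ⟪FluidPDE.timeDerivWithin (Icc 0 T)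
        (fun s x => v s x + vorticity v s x) σ x, v σ x + vorticity v σ x⟫) -
      (∫ σ in Ioo 0 T, ∫ x, φ x * ⟪FluidPDE.timeDerivWithin (Icc 0 T) v σ x, v σ x⟫) -
      (∫ σ in Ioo 0 T, ∫ x, φ x * ⟪FluidPDE.timeDerivWithin (Icc 0 T) (vorticity v) σ x, vorticity v σ x⟫) =
      ∫ σ in Ioo 0 T, (2 * (∫ x, (p σ x + ‖v σ x‖ ^ 2 / 2) * fderiv ℝ φ x (curl (v σ) x)) +
        ∫ x, ⟪FluidPDE.timeDerivWithin (Icc 0 T) v σ x, curlCLM ((fderiv ℝ φ x).smulRight (v σ x))⟫) := by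
    have split : (∫ σ in Ioo 0 T, ((∫ x, φ x * ⟪FluidPDE.timeDerivWithin (Icc 0 T)
        (fun s x => v s x + vorticity v s x) σ x, v σ x + vorticity v σ x⟫) -
        (∫ x, φ x * ⟪FluidPDE.timeDerivWithin (Icc 0 T) v σ x, v σ x⟫) -
        (∫ x, φ x * ⟪FluidPDE.timeDerivWithin (Icc 0 T) (vorticity v) σ x, vorticity v σ x⟫))) =
      (∫ σ in Ioo 0 T, ∫ x, φ x * ⟪FluidPDE.timeDerivWithin (Icc 0 T)
        (fun s x => v s x + vorticity v s x) σ x, v σ x + vorticity v σ x⟫) -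
      (∫ σ in Ioo 0 T, ∫ x, φ x * ⟪FluidPDE.timeDerivWithin (Icc 0 T) v σ x, v σ x⟫) -
      (∫ σ in Ioo 0 T, ∫ x, φ x * ⟪FluidPDE.timeDerivWithin (Icc 0 T) (vorticity v) σ x, vorticity v σ x⟫) := by
      rw [integral_sub (Integrable.sub' hiA hiB) hiC, integral_sub hiA hiB]
    have key : (∫ σ in Ioo 0 T, ((∫ x, φ x * ⟪FluidPDE.timeDerivWithin (Icc 0 T)
        (fun s x => v s x + vorticity v s x) σ x, v σ x + vorticity v σ x⟫) -
        (∫ x, φ x * ⟪FluidPDE.timeDerivWithin (Icc 0 T) v σ x, v σ x⟫) -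
        (∫ x, φ x * ⟪FluidPDE.timeDerivWithin (Icc 0 T) (vorticity v) σ x, vorticity v σ x⟫))) =
      ∫ σ in Ioo 0 T, (2 * (∫ x, (p σ x + ‖v σ x‖ ^ 2 / 2) * fderiv ℝ φ x (curl (v σ) x)) +
        ∫ x, ⟪FluidPDE.timeDerivWithin (Icc 0 T) v σ x, curlCLM ((fderiv ℝ φ x).smulRight (v σ x))⟫) :=
      setIntegral_congr_fun measurableSet_Ioo fun σ hσ => hσeq σ hσ
    rw [← key]
    exact split.symm
  rw [← hL, hA, hB, hC, ← hends T hTm, ← hends 0 h0m]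
  ring

end Balance

end Summit.NavierStokesRegularity.NavierStokesRegularity.Theorems.PowerGaugeEulerLiouville.Helicity

end
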